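import Mathlib.AlgebraicGeometry.Morphisms.Proper
import Mathlib.AlgebraicGeometry.Morphisms.Immersion
import Mathlib.AlgebraicGeometry.Morphisms.SchemeTheoreticallyDominant
import Mathlib.AlgebraicGeometry.Morphisms.Flat
import Mathlib.AlgebraicGeometry.Morphisms.FiniteType
import Mathlib.AlgebraicGeometry.Limits
import Mathlib.AlgebraicGeometry.Noetherian
import Literature.AlgebraicGeometry.Resolution.ChowLemma
import Literature.AlgebraicGeometry.Resolution.ChowLemmaProofs
import Literature.AlgebraicGeometry.Resolution.SchematicallyDense
import HarnessLib

/-!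
# Proof of Chow's lemma over a field, general case (`Literature.AlgebraicGeometry.Resolution.ChowLemma_holds`)

This file discharges the named fact `Literature.AlgebraicGeometry.Resolution.ChowLemma` of
`Literature/AlgebraicGeometry/Resolution/ChowLemma.lean`: for a field `k` and a separated
`k`-scheme `f : X → Spec k` of finite type (no integrality or irreducibility assumption) there are
`n`, a scheme `X'`, a proper surjective `π : X' → X`, an immersion `ι : X' → 𝐏ⁿ_k` over `k`, and
a dense open `U ⊆ X` with `π⁻¹(U) → U` an isomorphism.

The sibling file `ChowLemmaProofs.lean` proves the integral form `ChowLemmaIntegral_holds`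
(Görtz–Wedhorn I, Thm. 13.100 (2)) by the same "closure of the graph" construction for `X`
irreducible; we reuse from it the quasi-projectivity of affine schemes of finite type
(`ChowLemmaProof.exists_immersion_projectiveSpace`), the weak products of projective `k`-schemes
(`ChowLemmaProof.exists_weakProd`), scheme-theoretic dominance of `X → im` for quasi-compact
morphisms (`ChowLemmaProof.isSchemeTheoreticallyDominant_toImage`) and the gluing of immersions
(`ChowLemmaProof.isImmersion_of_iSup_preimage_eq_top`). What is new here is the general
(reducible, non-reduced) case, which needs (a) a finite affine open cover all of whose members
contain every generic point, so that its intersection is dense, and (b) scheme-theoretic density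
arguments (`IsSchemeTheoreticallyDominant`) in place of the density-plus-reducedness arguments
available in the integral case.

Source: The Stacks project, Cohomology of Schemes, Section 30.18 "Chow's lemma" (Tag 02O2), Lemma
30.18.1 (Tag 0200, with reference to EGA II Théorème 5.6.1(a)): "Let `S` be a Noetherian scheme. Let
`f : X → S` be a separated morphism of finite type. Then there exist an `n ≥ 0` and a diagram
`X ← X' → 𝐏ⁿ_S` over `S` where `X' → 𝐏ⁿ_S` is an immersion, and `π : X' → X` is proper and
surjective. Moreover, we may arrange it such that there exists a dense open subscheme `U ⊆ X` such
that `π⁻¹(U) → U` is an isomorphism." We prove the case `S = Spec k` vendored by `ChowLemma`.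

## Proof

We follow the printed proof (Tag 0200) with the classical "closure of the graph" presentation of
its middle part (EGA II 5.6.1; Hartshorne II Ex. 4.10), which avoids gluing `π`:

1. `X` is Noetherian, so it has finitely many irreducible components (Tag 0BA8), and every point has
   an affine open neighbourhood containing all generic points (Properties, Lemma 28.29.4,
   Tag 01ZX, in the finite form used in the proof of Tag 0200: a small affine neighbourhood of `x`
   together with disjoint affine opens around the remaining generic points is affine). By
   compactness we get a finite affine open cover `X = U₀ ∪ … ∪ Uₘ` each member of which contains
   all generic points, so that `U := ⋂ Uᵢ` is a dense open (`exists_affine_cover_dense_iInf`).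
2. Each `Uᵢ`, being affine of finite type over `k`, admits a `k`-immersion `jᵢ : Uᵢ → 𝐏^{nᵢ}_k`
   (Morphisms, Lemma 29.39.3, Tag 01VS, affine case;
   `ChowLemmaProof.exists_immersion_projectiveSpace` of the sibling file). Write
   `jᵢ = clᵢ ≫ (Aᵢ ↪ 𝐏^{nᵢ})` with `Aᵢ` open and `clᵢ` a closed immersion (Mathlib
   `Scheme.Hom.liftCoborder`).
3. `P := 𝐏^{n₀} ×ₖ … ×ₖ 𝐏^{nₘ}` is a projective `k`-scheme by the Segre embedding (Constructions,
   Lemma 27.13.6, Tag 01WD; `ChowLemmaProof.exists_weakProd`), in particular proper over `k`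
   (`Literature.AlgebraicGeometry.Motives.IsProjectiveOver.isProper`).
4. Let `e = (U ↪ X, (jᵢ|_U)ᵢ) : U → X ×ₖ P` and let `X'` be its scheme-theoretic image (Mathlib
   `Scheme.Hom.image`; Morphisms, Lemma 29.6.3, Tag 01R8: `U → X'` is scheme-theoretically
   dominant), `π : X' → X` and `ψ : X' → P` the projections.
   * `π` is proper (closed immersion, then base change of `P → Spec k`), and surjective because its
     image is closed and contains the dense open `U`.
   * `π⁻¹(U) → U` is an isomorphism: its section induced by `e` is a closed immersion (section of a
     separated morphism, Schemes, Lemma 26.21.11, Tag 01KT) with trivial kernel (it is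
     scheme-theoretically dominant), hence an isomorphism (`isIso_morphismRestrict`).
   * `ψ` is an immersion (`isImmersion_snd`): with `Vᵢ := prᵢ⁻¹(Aᵢ) ⊆ P` and `Wᵢ := ψ⁻¹(Vᵢ)`, one
     shows `Wᵢ = π⁻¹(Uᵢ)` (`chart_le`, `le_chart`) by two applications of "`S`-morphisms into a
     separated `S`-scheme agreeing on a scheme-theoretically dense open are equal" (Morphisms, Lemma
     29.7.10, Tag 01RH; `Literature.AlgebraicGeometry.Resolution.ext_of_isSchemeTheoreticallyDominant_of_isSeparated` of
     `Resolution/SchematicallyDense.lean`), and that `ψ|: Wᵢ → Vᵢ` is a closed immersion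
     (`isClosedImmersion_chart`): the closed immersion `Wᵢ ↪ X ×ₖ Vᵢ` factors through the graph
     `Vᵢ ×_{Aᵢ} Uᵢ ↪ X ×ₖ Vᵢ` of the retraction, itself a closed immersion since `X → Spec k` is
     separated. As the `Wᵢ` cover `X'`, `ψ` is an immersion
     (`ChowLemmaProof.isImmersion_of_iSup_preimage_eq_top`). Composing with `P ↪ 𝐏ᴺ` gives `ι`.

## References

* The Stacks project: Tag 0200 (Cohomology of Schemes, Lemma 30.18.1, Chow's lemma) in Section Tag
  02O2; Tags 01ZX, 0BA8, 01VS, 01WD, 01R8, 01RH, 01KT as indicated above. [StacksProject]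
* A. Grothendieck, EGA II, Théorème 5.6.1 (the reference printed in Tag 0200).
* R. Hartshorne, *Algebraic Geometry*, GTM 52 (1977): II Ex. 4.10 (Chow's Lemma, with the same
  proof sketch), II Thm. 4.9, II Ex. 5.11 (Segre). [Hartshorne1977]
* U. Görtz, T. Wedhorn, *Algebraic Geometry I: Schemes*, 2nd ed. (2020), Theorem 13.100 (Lemma of
  Chow), PDF p. 529 (the integral form, proved in the sibling file). [GortzWedhorn2020]

## Implementation notes

* All auxiliary results live in `Literature.AlgGeom.ChowLemmaProof` (the namespace of the sibling file;
  no name is reused); the construction with all its data is `ChowLemmaProof.exists_chow`, the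
  discharge is `Literature.AlgebraicGeometry.Resolution.ChowLemma_holds`. No definitions are introduced.
* The "one chart" section is written for an abstract configuration
  (`f : X → S` separated, `g : P → S`, `qᵢ : P → Pᵢ` over `S`, `clᵢ : Uᵢ → Aᵢ ⊆ Pᵢ`,
  `e : U₀ → X ×_S P` quasi-compact with prescribed components), so that it applies verbatim to every
  index `i`.
-/

universe u

open CategoryTheory Limits TopologicalSpace AlgebraicGeometry MonoidalCategory

noncomputable section

namespace Literature.AlgebraicGeometry.Resolution

namespace ChowLemmaProof

/-! ### Scheme-theoretic dominance and separatedness -/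

section DomExt

variable {W X Y Z : Scheme.{u}}

/-- Precomposing with a scheme-theoretically dominant morphism does not change the kernel ideal
sheaf. [folklore] -/
theorem ker_comp_of_isSchemeTheoreticallyDominant (u : W ⟶ X) [IsSchemeTheoreticallyDominant u]
    (r : X ⟶ Y) : (u ≫ r).ker = r.ker := by
  rw [Scheme.Hom.ker_comp, u.ker_eq_bot, Scheme.IdealSheafData.map_bot]

/-- A section of a separated morphism is a closed immersion (Stacks, Schemes Lemma 26.21.11).
[cite: StacksProject, Tag 01KT] -/
theorem isClosedImmersion_of_comp_eq_id' (s : X ⟶ Y) (p : Y ⟶ X) [IsSeparated p]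
    (h : s ≫ p = 𝟙 X) : IsClosedImmersion s :=
  have : IsClosedImmersion (s ≫ p) := h ▸ inferInstance
  .of_comp s p

/-- A scheme-theoretically dominant section of a separated morphism is an isomorphism: it is a
closed immersion (Tag 01KT) with zero kernel. [cite: StacksProject, Tag 01KT] -/
theorem isIso_of_comp_eq_id_of_isSchemeTheoreticallyDominant (s : X ⟶ Y) (p : Y ⟶ X)
    [IsSeparated p] [IsSchemeTheoreticallyDominant s] (h : s ≫ p = 𝟙 X) : IsIso s :=
  have := isClosedImmersion_of_comp_eq_id' s p h
  IsClosedImmersion.isIso_iff_ker_eq_bot.mpr s.ker_eq_bot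

/-- A separated morphism with a scheme-theoretically dominant section is an isomorphism.
[cite: StacksProject, Tag 01KT] -/
theorem isIso_of_section_of_isSchemeTheoreticallyDominant (s : X ⟶ Y) (p : Y ⟶ X)
    [IsSeparated p] [IsSchemeTheoreticallyDominant s] (h : s ≫ p = 𝟙 X) : IsIso p :=
  have := isIso_of_comp_eq_id_of_isSchemeTheoreticallyDominant s p h
  have : p = inv s := by rw [← cancel_epi s, h, IsIso.hom_inv_id]
  this ▸ inferInstance

/-- If `u ≫ r = v ≫ c` with `u` scheme-theoretically dominant then `ker c ≤ ker r`; with `c` a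
closed immersion this says that `r` factors through `c` (Mathlib `IsClosedImmersion.lift`).
[folklore] -/
theorem ker_le_ker_of_isSchemeTheoreticallyDominant {A B : Scheme.{u}} (u : W ⟶ X)
    [IsSchemeTheoreticallyDominant u] (r : X ⟶ A) (v : W ⟶ B) (c : B ⟶ A)
    (h : u ≫ r = v ≫ c) : c.ker ≤ r.ker := by
  rw [← ker_comp_of_isSchemeTheoreticallyDominant u r, h]
  exact Scheme.Hom.le_ker_comp _ _

end DomExt

/-! ### Affine open covers with dense intersection -/

section AffineCover

variable (X : Scheme.{u})

section Topology

variable {α : Type*} [TopologicalSpace α]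

/-- The complement of the union of the irreducible components other than `Z` is contained
in `Z`. [folklore] -/
theorem compl_sUnion_irreducibleComponents_sdiff_subset (Z : Set α) :
    (⋃₀ (irreducibleComponents α \ {Z}))ᶜ ⊆ Z := by
  intro y hy
  by_contra hyZ
  apply hy
  exact ⟨irreducibleComponent y, ⟨irreducibleComponent_mem_irreducibleComponents y, fun h ↦
    hyZ (h ▸ mem_irreducibleComponent)⟩, mem_irreducibleComponent⟩

/-- Distinct irreducible components: a generic point of one does not lie in the other. [folklore] -/
theorem not_mem_of_isGenericPoint_of_ne {Z Z' : Set α} (hZ : Z ∈ irreducibleComponents α)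
    (hZ' : Z' ∈ irreducibleComponents α) (hne : Z ≠ Z') {η : α} (hη : IsGenericPoint η Z) :
    η ∉ Z' := by
  intro h
  have hsub : Z ⊆ Z' := by
    rw [← hη.def]
    exact closure_minimal (Set.singleton_subset_iff.mpr h)
      (isClosed_of_mem_irreducibleComponents _ hZ')
  exact hne (hsub.antisymm (hZ.2 hZ'.1 hsub))

/-- A set containing all generic points of irreducible components (of a quasi-sober space) is
dense. [folklore] -/
theorem dense_of_genericPoints_subset [QuasiSober α] {U : Set α} (hU : genericPoints α ⊆ U) :
    Dense U := by
  rw [dense_iff_closure_eq, ← Set.univ_subset_iff, ← genericPoints.closure]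
  exact closure_mono hU

end Topology

variable {X} in
/-- In a scheme with finitely many irreducible components, every point `x` has an affine open
neighbourhood containing all the generic points of the irreducible components (Stacks, Properties
Lemma 28.29.4, Tag 01ZX, in the finite form used in the proof of Tag 0200; proof as printed there: a
small affine neighbourhood of `x` meeting only the components through `x`, together with pairwise
disjoint affine opens around the other generic points, is a disjoint union of affines, hence
affine). [cite: StacksProject, Tag 01ZX] -/
theorem exists_isAffineOpen_genericPoints_subset (hfin : (irreducibleComponents X).Finite)
    (x : X) : ∃ U : X.Opens, IsAffineOpen U ∧ x ∈ U ∧ genericPoints X ⊆ (U : Set X) := by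
  classical
  -- the components not containing `x`
  let S : Set (Set X) := {Z ∈ irreducibleComponents X | x ∉ Z}
  have hSfin : S.Finite := hfin.subset (Set.sep_subset _ _)
  have hC : IsClosed (⋃₀ S) := by
    rw [Set.sUnion_eq_biUnion]
    exact hSfin.isClosed_biUnion fun Z hZ ↦ isClosed_of_mem_irreducibleComponents _ hZ.1
  have hxC : x ∈ (⋃₀ S)ᶜ := fun ⟨Z, hZ, hxZ⟩ ↦ hZ.2 hxZ
  obtain ⟨_, ⟨V, hV : IsAffineOpen V, rfl⟩, hxV, hVC⟩ :=
    X.isBasis_affineOpens.exists_subset_of_mem_open hxC hC.isOpen_compl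
  -- for each component `Z` not containing `x`, an affine open inside `Z` containing its
  -- generic point
  let O : Set X → Set X := fun Z ↦ (⋃₀ (irreducibleComponents X \ {Z}))ᶜ
  have hO : ∀ Z, IsOpen (O Z) := fun Z ↦ by
    have : IsClosed (⋃₀ (irreducibleComponents X \ {Z})) := by
      rw [Set.sUnion_eq_biUnion]
      exact (hfin.subset Set.sdiff_subset).isClosed_biUnion fun Z' hZ' ↦
        isClosed_of_mem_irreducibleComponents _ hZ'.1
    exact this.isOpen_compl
  have hOZ : ∀ Z ∈ irreducibleComponents X, O Z ⊆ Z := fun Z _ ↦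
    compl_sUnion_irreducibleComponents_sdiff_subset Z
  have hηO : ∀ Z (hZ : Z ∈ irreducibleComponents X),
      (genericPoints.ofComponent ⟨Z, hZ⟩).1 ∈ O Z := by
    intro Z hZ ⟨Z', ⟨hZ', hZ'Z⟩, hη⟩
    exact not_mem_of_isGenericPoint_of_ne hZ hZ' (Ne.symm hZ'Z)
      (genericPoints.isGenericPoint_ofComponent ⟨Z, hZ⟩) hη
  have hW : ∀ Z : S, ∃ W : X.Opens, IsAffineOpen W ∧
      (genericPoints.ofComponent ⟨Z.1, Z.2.1⟩).1 ∈ W ∧ (W : Set X) ⊆ O Z := by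
    intro Z
    obtain ⟨_, ⟨W, hW : IsAffineOpen W, rfl⟩, hηW, hWO⟩ :=
      X.isBasis_affineOpens.exists_subset_of_mem_open (hηO Z.1 Z.2.1) (hO Z)
    exact ⟨W, hW, hηW, hWO⟩
  choose W hWaff hηW hWO using hW
  -- the disjoint family
  have : Finite S := hSfin
  let F : Option S → X.Opens := fun o ↦ o.elim V W
  have hFaff : ∀ o, IsAffineOpen (F o) := by
    rintro (_ | Z)
    · exact hV
    · exact hWaff Z
  have hWZ : ∀ Z : S, (W Z : Set X) ⊆ Z.1 := fun Z ↦ (hWO Z).trans (hOZ Z.1 Z.2.1)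
  have hVZ : ∀ Z : S, Disjoint (V : Set X) Z.1 := fun Z ↦
    Set.disjoint_left.mpr fun y hyV hyZ ↦ hVC hyV ⟨Z.1, Z.2, hyZ⟩
  have hdisj : Pairwise (Function.onFun Disjoint F) := by
    rintro (_ | Z) (_ | Z') hne
    · exact (hne rfl).elim
    · change Disjoint V (W Z')
      rw [← Opens.coe_disjoint]
      exact (hVZ Z').mono_right (hWZ Z')
    · change Disjoint (W Z) V
      rw [← Opens.coe_disjoint]
      exact ((hVZ Z).mono_right (hWZ Z)).symm
    · change Disjoint (W Z) (W Z')
      have hZZ' : Z.1 ≠ Z'.1 := fun h ↦ hne (congrArg some (Subtype.ext h))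
      rw [← Opens.coe_disjoint]
      refine Set.disjoint_left.mpr fun y hy hy' ↦ hWO Z' hy' ⟨Z.1, ⟨Z.2.1, hZZ'⟩, hWZ Z hy⟩
  refine ⟨⨆ o, F o, IsAffineOpen.iSup_of_disjoint hFaff hdisj, ?_, ?_⟩
  · exact Opens.mem_iSup.mpr ⟨none, hxV⟩
  · intro η hη
    -- `η` is the generic point of the component `closure {η}`
    let Z : Set X := closure {η}
    have hZ : Z ∈ irreducibleComponents X := hη
    have hηZ : IsGenericPoint η Z := isGenericPoint_closure
    simp only [Opens.coe_iSup, Set.mem_iUnion]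
    by_cases hxZ : x ∈ Z
    · refine ⟨none, ?_⟩
      change η ∈ (V : Set X)
      exact (hηZ.mem_open_set_iff V.isOpen).mpr ⟨x, hxZ, hxV⟩
    · refine ⟨some ⟨Z, hZ, hxZ⟩, ?_⟩
      change η ∈ (W ⟨Z, hZ, hxZ⟩ : Set X)
      have h := hηW ⟨Z, hZ, hxZ⟩
      rwa [← hηZ.eq (genericPoints.isGenericPoint_ofComponent ⟨Z, hZ⟩)] at h

/-- A quasi-compact scheme with finitely many irreducible components has a finite affine open
cover, indexed by `Fin (m + 1)`, all of whose members contain every generic point; in particular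
the intersection of the cover is a dense open (Stacks, proof of Tag 0200, first paragraph: "we can
find a finite affine open covering `X = U_1 ∪ … ∪ U_m` such that each `U_i` contains
`η_1, …, η_r`. In particular we conclude that the open `U = U_1 ∩ … ∩ U_m ⊂ X` is a dense open").
[cite: StacksProject, Tag 0200 (proof)] -/
theorem exists_affine_cover_dense_iInf [CompactSpace X]
    (hfin : (irreducibleComponents X).Finite) :
    ∃ (m : ℕ) (U : Fin (m + 1) → X.Opens), (∀ i, IsAffineOpen (U i)) ∧ ⨆ i, U i = ⊤ ∧
      genericPoints X ⊆ ((⨅ i, U i : X.Opens) : Set X) ∧ Dense ((⨅ i, U i : X.Opens) : Set X) := by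
  classical
  choose U hUaff hxU hgen using exists_isAffineOpen_genericPoints_subset hfin
  obtain ⟨t, ht⟩ := isCompact_univ.elim_finite_subcover (fun x ↦ (U x : Set X))
    (fun x ↦ (U x).isOpen) fun x _ ↦ Set.mem_iUnion.mpr ⟨x, hxU x⟩
  rcases isEmpty_or_nonempty X with hX | ⟨⟨x₀⟩⟩
  · refine ⟨0, fun _ ↦ ⊤, fun _ ↦ ?_, ?_, ?_, ?_⟩
    · exact isAffineOpen_top X
    · simp
    · exact fun η _ ↦ by simp
    · exact fun η ↦ (IsEmpty.false η).elim
  -- enumerate `t`, padding with `x₀`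
  let e : Fin (t.card + 1) → X := fun i ↦ Fin.cases x₀ (fun j ↦ (t.equivFin.symm j).1) i
  refine ⟨t.card, fun i ↦ U (e i), fun i ↦ hUaff _, ?_, ?_, ?_⟩
  · rw [eq_top_iff]
    rintro y -
    obtain ⟨x, hx⟩ := Set.mem_iUnion.mp (ht (Set.mem_univ y))
    obtain ⟨hxt, hy⟩ := Set.mem_iUnion.mp hx
    refine Opens.mem_iSup.mpr ⟨Fin.succ (t.equivFin ⟨x, hxt⟩), ?_⟩
    simpa [e] using hy
  · intro η hη
    simp only [Opens.coe_iInf, Set.mem_iInter]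
    exact fun i ↦ hgen _ hη
  · apply dense_of_genericPoints_subset
    intro η hη
    simp only [Opens.coe_iInf, Set.mem_iInter]
    exact fun i ↦ hgen _ hη

/-- A Noetherian scheme has a finite affine open cover with dense intersection (Stacks, proof of
Tag 0200, first paragraph, using Tag 0BA8 for the finiteness of the set of irreducible components).
[cite: StacksProject, Tag 0200 (proof)] -/
theorem exists_affine_cover_dense_iInf_of_isNoetherian [IsNoetherian X] :
    ∃ (m : ℕ) (U : Fin (m + 1) → X.Opens), (∀ i, IsAffineOpen (U i)) ∧ ⨆ i, U i = ⊤ ∧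
      genericPoints X ⊆ ((⨅ i, U i : X.Opens) : Set X) ∧ Dense ((⨅ i, U i : X.Opens) : Set X) :=
  exists_affine_cover_dense_iInf X finite_irreducibleComponents_of_isNoetherian

end AffineCover

/-! ### The closure of the graph -/

/-! ### Generalities -/

section General

variable {X Y : Scheme.{u}}

/-- The image of `f` lies in the open `W` iff `f⁻¹(W)` is everything. [folklore] -/
theorem range_subset_iff_preimage_eq_top (f : X ⟶ Y) (W : Y.Opens) :
    Set.range f ⊆ (W : Set Y) ↔ f ⁻¹ᵁ W = ⊤ := by
  rw [Set.range_subset_iff, Opens.ext_iff, Opens.coe_top, Set.eq_univ_iff_forall]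
  rfl

/-- An open `U` is contained in `V` if the preimage of `V` in `U` is everything. [folklore] -/
theorem opens_le_of_ι_preimage_eq_top {U V : X.Opens}
    (h : U.ι ⁻¹ᵁ V = ⊤) : U ≤ V := by
  rw [← U.ι_image_top, ← h]
  exact U.ι.image_preimage_le V

/-- If `f⁻¹(W)` is everything then `f` factors (set-theoretically) through `W ↪ Y`. [folklore] -/
theorem range_subset_range_ι_of_preimage_eq_top (f : X ⟶ Y) (W : Y.Opens) (h : f ⁻¹ᵁ W = ⊤) :
    Set.range f ⊆ Set.range W.ι := by
  rw [Scheme.Opens.range_ι]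
  exact (range_subset_iff_preimage_eq_top f W).mpr h

variable {U : Scheme.{u}} (e : U ⟶ X) [IsSchemeTheoreticallyDominant e] [QuasiCompact e]

/-- A scheme-theoretically dominant quasi-compact morphism stays scheme-theoretically dominant
when co-restricted to an open containing its image (flat base change, Mathlib
`IsSchemeTheoreticallyDominant.of_isPullback`; Stacks Morphisms Lemma 29.6.3 (3)).
[cite: StacksProject, Tag 01R8] -/
theorem isSchemeTheoreticallyDominant_lift (W : X.Opens) (h : Set.range e ⊆ Set.range W.ι) :
    IsSchemeTheoreticallyDominant (IsOpenImmersion.lift W.ι e h) :=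
  IsSchemeTheoreticallyDominant.of_isPullback (IsOpenImmersion.isPullback_lift_id e W.ι h).flip

end General

/-! ### One chart -/

section Chart

variable {S X P Pi : Scheme.{u}} (f : X ⟶ S) (g : P ⟶ S) (hPi : Pi ⟶ S) (qi : P ⟶ Pi)
  (hqi : qi ≫ hPi = g) (Ui U₀ : X.Opens) (hle : U₀ ≤ Ui) (A : Pi.Opens)
  (cl : (Ui : Scheme.{u}) ⟶ A) [IsClosedImmersion cl] (hcl : cl ≫ A.ι ≫ hPi = Ui.ι ≫ f)
  (e : (U₀ : Scheme.{u}) ⟶ pullback f g)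
  [QuasiCompact e] (he₁ : e ≫ pullback.fst f g = U₀.ι)
  (he₂ : e ≫ pullback.snd f g ≫ qi = X.homOfLE hle ≫ cl ≫ A.ι)

/-- The projection `π : X' → X` of the scheme-theoretic image `X'` of `e`. -/
local notation3 "π" => Scheme.Hom.imageι e ≫ pullback.fst f g
/-- The open `Q = X ×_S Vᵢ` of `X ×_S P`, where `Vᵢ = qᵢ⁻¹(Aᵢ)`. -/
local notation3 "Q" => pullback.snd f g ⁻¹ᵁ (qi ⁻¹ᵁ A)
/-- The chart `Wᵢ = ψ⁻¹(Vᵢ)` of `X'`, `ψ : X' → P` the projection. -/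
local notation3 "W" => Scheme.Hom.imageι e ⁻¹ᵁ (pullback.snd f g ⁻¹ᵁ (qi ⁻¹ᵁ A))
/-- `ψ` restricted to `Wᵢ → Vᵢ`. -/
local notation3 "ψV" => (Scheme.Hom.imageι e ∣_ Q) ≫ (pullback.snd f g ∣_ (qi ⁻¹ᵁ A))

include he₂ in
omit [IsClosedImmersion cl] [QuasiCompact e] in
/-- `U₀ → X'` lands in the chart `Wᵢ`. [folklore] -/
theorem toImage_preimage_eq_top : e.toImage ⁻¹ᵁ W = ⊤ := by
  rw [← Scheme.Hom.comp_preimage, ← Scheme.Hom.comp_preimage, ← Scheme.Hom.comp_preimage]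
  simp only [Category.assoc, Scheme.Hom.toImage_imageι_assoc]
  rw [he₂, Scheme.Hom.comp_preimage, Scheme.Hom.comp_preimage, Scheme.Opens.ι_preimage_self]
  simp

include hle he₁ in
omit [QuasiCompact e] in
/-- `U₀ → X'` lands in `π⁻¹(Uᵢ)`. [folklore] -/
theorem toImage_preimage_eq_top' : e.toImage ⁻¹ᵁ ((π) ⁻¹ᵁ Ui) = ⊤ := by
  rw [← Scheme.Hom.comp_preimage]
  simp only [Scheme.Hom.toImage_imageι_assoc]
  rw [he₁, ← X.homOfLE_ι hle, Scheme.Hom.comp_preimage, Scheme.Opens.ι_preimage_self]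
  simp

omit [IsClosedImmersion cl] [QuasiCompact e] in
/-- Compatibility of the restricted projection `Wᵢ → Vᵢ` with `ψ : X' → P`. [folklore] -/
theorem ψV_ι : (ψV) ≫ (qi ⁻¹ᵁ A).ι = (W).ι ≫ e.imageι ≫ pullback.snd f g := by
  rw [Category.assoc, morphismRestrict_ι, morphismRestrict_ι_assoc]

include hqi hcl he₁ he₂ in
/-- The retraction `r' : Wᵢ → Uᵢ` of the chart `Wᵢ = ψ⁻¹(Vᵢ)`: the map `Wᵢ → Aᵢ` factors through
the closed immersion `clᵢ : Uᵢ → Aᵢ` because it does so on the scheme-theoretically dense `U₀`, and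
`π|_{Wᵢ} = r' ≫ (Uᵢ ↪ X)` by equality of morphisms into the separated `S`-scheme `X` (Tag 01RH)
(Stacks, proof of Tag 0200: "the morphisms `pᵢ|_{Vᵢ} : Vᵢ → Uᵢ`").
[cite: StacksProject, Tag 0200 (proof)] -/
theorem exists_retraction [IsSeparated f] :
    ∃ r' : ((W : (e.image).Opens) : Scheme.{u}) ⟶ Ui,
      r' ≫ cl = (ψV) ≫ (qi ∣_ A) ∧ (W).ι ≫ π = r' ≫ Ui.ι := by
  haveI := isSchemeTheoreticallyDominant_toImage e
  -- the dominant map `u : U₀ → Wᵢ`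
  have hW : Set.range e.toImage ⊆ Set.range (W).ι :=
    range_subset_range_ι_of_preimage_eq_top _ _
      (toImage_preimage_eq_top f g qi Ui U₀ hle A cl e he₂)
  let u := IsOpenImmersion.lift (W).ι e.toImage hW
  haveI : IsSchemeTheoreticallyDominant u := isSchemeTheoreticallyDominant_lift e.toImage _ hW
  have hu : u ≫ (W).ι = e.toImage := IsOpenImmersion.lift_fac _ _ _
  -- the map `r : Wᵢ → Aᵢ`
  let r : (W : Scheme.{u}) ⟶ A := (ψV) ≫ (qi ∣_ A)
  have hr : r ≫ A.ι = (W).ι ≫ e.imageι ≫ pullback.snd f g ≫ qi := by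
    simp only [r, Category.assoc, morphismRestrict_ι]
    rw [reassoc_of% (ψV_ι (f := f) (g := g) (qi := qi) (A := A) (e := e))]
  have E1 : u ≫ r = X.homOfLE hle ≫ cl := by
    rw [← cancel_mono A.ι]
    simp only [Category.assoc, hr]
    rw [reassoc_of% hu]
    simp only [Scheme.Hom.toImage_imageι_assoc]
    rw [he₂]
  have hker : cl.ker ≤ r.ker := ker_le_ker_of_isSchemeTheoreticallyDominant u r _ _ E1
  let r' := IsClosedImmersion.lift cl r hker
  have hr' : r' ≫ cl = r := IsClosedImmersion.lift_fac _ _ _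
  have E2 : u ≫ r' = X.homOfLE hle := by
    rw [← cancel_mono cl, Category.assoc, hr', E1]
  refine ⟨r', hr', ?_⟩
  refine ext_of_isSchemeTheoreticallyDominant_of_isSeparated f ?_ u ?_
  · simp only [Category.assoc, pullback.condition, ← hqi]
    rw [← hcl, reassoc_of% hr', reassoc_of% hr]
  · rw [reassoc_of% hu]
    simp only [Scheme.Hom.toImage_imageι_assoc]
    rw [he₁, reassoc_of% E2, Scheme.homOfLE_ι]

include hqi hcl he₁ he₂ in
/-- `Wᵢ ⊆ π⁻¹(Uᵢ)` (Stacks, proof of Tag 0200: "`Vᵢ ⊂ π⁻¹(Uᵢ)`").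
[cite: StacksProject, Tag 0200 (proof)] -/
theorem chart_le [IsSeparated f] : W ≤ (π) ⁻¹ᵁ Ui := by
  obtain ⟨r', -, E3⟩ := exists_retraction f g hPi qi hqi Ui U₀ hle A cl hcl e he₁ he₂
  refine opens_le_of_ι_preimage_eq_top ?_
  change ((W).ι ≫ π) ⁻¹ᵁ Ui = ⊤
  rw [E3, Scheme.Hom.comp_preimage, Scheme.Opens.ι_preimage_self]
  simp

include hqi hcl hle he₁ he₂ in
omit [IsClosedImmersion cl] in
/-- `π⁻¹(Uᵢ) ⊆ Wᵢ`, by equality of the two `S`-morphisms `π⁻¹(Uᵢ) → Pᵢ` (via `ψ` and via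
`π` and `jᵢ`) into the separated `S`-scheme `Pᵢ`, which agree on `U₀` (Tag 01RH; Stacks, proof
of Tag 0200: "we conclude that `Vᵢ = π⁻¹(Uᵢ)`"). [cite: StacksProject, Tag 0200 (proof)] -/
theorem le_chart [IsSeparated hPi] : (π) ⁻¹ᵁ Ui ≤ W := by
  haveI := isSchemeTheoreticallyDominant_toImage e
  let W' : (e.image).Opens := (π) ⁻¹ᵁ Ui
  have hW' : Set.range e.toImage ⊆ Set.range W'.ι :=
    range_subset_range_ι_of_preimage_eq_top _ _ (toImage_preimage_eq_top' f g Ui U₀ hle e he₁)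
  let u' := IsOpenImmersion.lift W'.ι e.toImage hW'
  haveI : IsSchemeTheoreticallyDominant u' := isSchemeTheoreticallyDominant_lift e.toImage W' hW'
  have hu' : u' ≫ W'.ι = e.toImage := IsOpenImmersion.lift_fac _ _ _
  have hud : u' ≫ ((π) ∣_ Ui) = X.homOfLE hle := by
    rw [← cancel_mono Ui.ι, Category.assoc, morphismRestrict_ι, reassoc_of% hu']
    simp only [Scheme.Hom.toImage_imageι_assoc]
    rw [he₁, Scheme.homOfLE_ι]
  -- the two maps `W' → Pᵢ` agree
  have hcd : W'.ι ≫ e.imageι ≫ pullback.snd f g ≫ qi = ((π) ∣_ Ui) ≫ cl ≫ A.ι := by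
    refine ext_of_isSchemeTheoreticallyDominant_of_isSeparated hPi ?_ u' ?_
    · simp only [Category.assoc, hqi, hcl]
      rw [morphismRestrict_ι_assoc]
      simp only [Category.assoc, pullback.condition]
      rfl
    · rw [reassoc_of% hu', reassoc_of% hud]
      simp only [Scheme.Hom.toImage_imageι_assoc]
      rw [he₂]
  refine opens_le_of_ι_preimage_eq_top ?_
  change (W'.ι ≫ e.imageι ≫ pullback.snd f g ≫ qi) ⁻¹ᵁ A = ⊤
  rw [hcd, Scheme.Hom.comp_preimage, Scheme.Hom.comp_preimage, Scheme.Opens.ι_preimage_self]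
  simp

include hqi hcl he₁ he₂ in
/-- `ψ` restricted to `Wᵢ → Vᵢ` is a closed immersion: the closed immersion `Wᵢ ↪ X ×_S Vᵢ`
factors through the graph `Vᵢ ×_{Aᵢ} Uᵢ ↪ X ×_S Vᵢ` of the retraction, a closed immersion because
`X → S` is separated (Stacks, proof of Tag 0200 and Remark Tag 0201 (1)).
[cite: StacksProject, Tag 0200 (proof)] -/
theorem isClosedImmersion_chart [IsSeparated f] : IsClosedImmersion (ψV) := by
  obtain ⟨r', hr', E3⟩ := exists_retraction f g hPi qi hqi Ui U₀ hle A cl hcl e he₁ he₂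
  -- `Vᵢ' = Vᵢ ×_{Aᵢ} Uᵢ`
  let v₁ := pullback.fst (qi ∣_ A) cl
  let v₂ := pullback.snd (qi ∣_ A) cl
  let ψ' : (W : Scheme.{u}) ⟶ pullback (qi ∣_ A) cl := pullback.lift (ψV) r' hr'.symm
  have hψ' : ψ' ≫ v₁ = ψV := pullback.lift_fst _ _ _
  suffices IsClosedImmersion ψ' by rw [← hψ']; infer_instance
  -- the graph `Γ : Vᵢ' → Q = X ×_S Vᵢ`
  have hcompat : (v₂ ≫ Ui.ι) ≫ f = (v₁ ≫ (qi ⁻¹ᵁ A).ι) ≫ g := by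
    simp only [Category.assoc, ← hcl, ← hqi]
    rw [← pullback.condition_assoc, morphismRestrict_ι_assoc]
  let ΓXP : pullback (qi ∣_ A) cl ⟶ pullback f g :=
    pullback.lift (v₂ ≫ Ui.ι) (v₁ ≫ (qi ⁻¹ᵁ A).ι) hcompat
  have hΓXP : Set.range ΓXP ⊆ Set.range (Q).ι := by
    refine range_subset_range_ι_of_preimage_eq_top _ _ ?_
    rw [← Scheme.Hom.comp_preimage, pullback.lift_snd, Scheme.Hom.comp_preimage,
      Scheme.Opens.ι_preimage_self]
    simp
  let Γ := IsOpenImmersion.lift (Q).ι ΓXP hΓXP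
  have hΓ : Γ ≫ (Q).ι = ΓXP := IsOpenImmersion.lift_fac _ _ _
  have hΓv₁ : Γ ≫ (pullback.snd f g ∣_ (qi ⁻¹ᵁ A)) = v₁ := by
    rw [← cancel_mono (qi ⁻¹ᵁ A).ι, Category.assoc, morphismRestrict_ι, reassoc_of% hΓ,
      pullback.lift_snd]
  haveI : IsClosedImmersion Γ := by
    have : IsClosedImmersion (Γ ≫ (pullback.snd f g ∣_ (qi ⁻¹ᵁ A))) := by
      rw [hΓv₁]; infer_instance
    exact .of_comp Γ (pullback.snd f g ∣_ (qi ⁻¹ᵁ A))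
  -- `e.imageι` restricted over `Q` factors as `ψ' ≫ Γ`
  have hfac : e.imageι ∣_ Q = ψ' ≫ Γ := by
    rw [← cancel_mono (Q).ι, morphismRestrict_ι, Category.assoc, hΓ]
    apply pullback.hom_ext
    · rw [Category.assoc, Category.assoc, pullback.lift_fst, ← Category.assoc ψ', pullback.lift_snd,
        E3]
    · rw [Category.assoc, Category.assoc, pullback.lift_snd, ← Category.assoc ψ', hψ',
        ψV_ι (f := f) (g := g) (qi := qi) (A := A) (e := e)]
  have : IsClosedImmersion (ψ' ≫ Γ) := by rw [← hfac]; infer_instance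
  exact .of_comp ψ' Γ

end Chart

/-! ### Globalisation -/

section Global

variable {X' P : Scheme.{u}}

variable {S X : Scheme.{u}} (f : X ⟶ S) (g : P ⟶ S) (U₀ : X.Opens)
  (e : (U₀ : Scheme.{u}) ⟶ pullback f g) [QuasiCompact e] (he₁ : e ≫ pullback.fst f g = U₀.ι)

include he₁ in
/-- `π : X' → X` is an isomorphism over `U₀`: the section `U₀ → π⁻¹(U₀)` induced by `e` is a
scheme-theoretically dominant closed immersion (Stacks, proof of Tag 0200, last paragraph:
"`π⁻¹(U) = U`"). [cite: StacksProject, Tag 0200 (proof)] -/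
theorem isIso_morphismRestrict [IsSeparated g] :
    IsIso ((e.imageι ≫ pullback.fst f g) ∣_ U₀) := by
  haveI := isSchemeTheoreticallyDominant_toImage e
  have hW : Set.range e.toImage ⊆ Set.range ((e.imageι ≫ pullback.fst f g) ⁻¹ᵁ U₀).ι :=
    range_subset_range_ι_of_preimage_eq_top _ _
      (toImage_preimage_eq_top' f g U₀ U₀ le_rfl e he₁)
  let s := IsOpenImmersion.lift _ e.toImage hW
  haveI := isSchemeTheoreticallyDominant_lift e.toImage _ hW
  have hs : s ≫ ((e.imageι ≫ pullback.fst f g) ∣_ U₀) = 𝟙 _ := by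
    rw [← cancel_mono U₀.ι, Category.assoc, morphismRestrict_ι, IsOpenImmersion.lift_fac_assoc,
      Scheme.Hom.toImage_imageι_assoc, he₁, Category.id_comp]
  exact isIso_of_section_of_isSchemeTheoreticallyDominant s _ hs

include he₁ in
omit [QuasiCompact e] in
/-- `π : X' → X` is surjective as soon as `U₀` is dense, its image being closed (`P → S`
universally closed) and containing `U₀`. [cite: StacksProject, Tag 0200 (proof)] -/
theorem surjective [UniversallyClosed g] (hU₀ : Dense (U₀ : Set X)) :
    Surjective (e.imageι ≫ pullback.fst f g) := by
  haveI : IsDominant (e.imageι ≫ pullback.fst f g) := by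
    refine ⟨hU₀.mono ?_⟩
    rw [← U₀.range_ι, ← he₁, ← e.toImage_imageι_assoc]
    rintro _ ⟨x, rfl⟩
    exact ⟨e.toImage x, rfl⟩
  exact Surjective.of_universallyClosed_of_isDominant _

end Global

/-! ### All charts -/

section Family

variable {S X P : Scheme.{u}} (f : X ⟶ S) (g : P ⟶ S) {ι : Type*} (Pi : ι → Scheme.{u})
  (hPi : ∀ i, Pi i ⟶ S) (qi : ∀ i, P ⟶ Pi i) (hqi : ∀ i, qi i ≫ hPi i = g)
  (Ui : ι → X.Opens) (U₀ : X.Opens) (hle : ∀ i, U₀ ≤ Ui i) (A : ∀ i, (Pi i).Opens)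
  (cl : ∀ i, (Ui i : Scheme.{u}) ⟶ A i) [∀ i, IsClosedImmersion (cl i)]
  (hcl : ∀ i, cl i ≫ (A i).ι ≫ hPi i = (Ui i).ι ≫ f)
  (e : (U₀ : Scheme.{u}) ⟶ pullback f g) [QuasiCompact e] (he₁ : e ≫ pullback.fst f g = U₀.ι)
  (he₂ : ∀ i, e ≫ pullback.snd f g ≫ qi i = X.homOfLE (hle i) ≫ cl i ≫ (A i).ι)
  (hcov : ⨆ i, Ui i = ⊤)

include hPi hqi Ui hle A cl hcl he₁ he₂ hcov in
/-- The projection `ψ : X' → P` of the scheme-theoretic closure `X'` of the graph is an immersion,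
provided the `Uᵢ` cover `X`: it is a closed immersion over each `Vᵢ` and the `ψ⁻¹(Vᵢ) ⊇ π⁻¹(Uᵢ)`
cover `X'` (Stacks, proof of Tag 0200: "By construction `X'` has an immersion into the scheme
`𝐏^{n₁}_S ×_S … ×_S 𝐏^{nₘ}_S`"; gluing by `ChowLemmaProof.isImmersion_of_iSup_preimage_eq_top`).
[cite: StacksProject, Tag 0200 (proof)] -/
theorem isImmersion_snd [IsSeparated f] [∀ i, IsSeparated (hPi i)] :
    IsImmersion (e.imageι ≫ pullback.snd f g) := by
  refine isImmersion_of_iSup_preimage_eq_top _ (fun i ↦ qi i ⁻¹ᵁ A i) ?_ fun i ↦ ?_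
  · rw [eq_top_iff, ← Scheme.Hom.preimage_top (e.imageι ≫ pullback.fst f g), ← hcov,
      Scheme.Hom.preimage_iSup]
    exact iSup_mono fun i ↦ le_chart f g (hPi i) (qi i) (hqi i) (Ui i) U₀ (hle i) (A i) (cl i)
      (hcl i) e he₁ (he₂ i)
  · have h : IsClosedImmersion ((e.imageι ≫ pullback.snd f g) ∣_ (qi i ⁻¹ᵁ A i)) := by
      rw [morphismRestrict_comp]
      exact isClosedImmersion_chart f g (hPi i) (qi i) (hqi i) (Ui i) U₀ (hle i) (A i) (cl i)
        (hcl i) e he₁ (he₂ i)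
    change IsImmersion (((e.imageι ≫ pullback.snd f g) ⁻¹ᵁ (qi i ⁻¹ᵁ A i)).ι ≫ _)
    rw [← morphismRestrict_ι]
    infer_instance

end Family

/-! ### The construction over a field, and the discharge -/

/-- **Chow's lemma over a field, with the data of the construction**: for `f : X → Spec k`
separated of finite type there are `n`, `X'`, `π : X' → X` proper surjective, an immersion
`ι : X' → 𝐏ⁿ_k` over `k`, a dense open `U ⊆ X` over which `π` is an isomorphism, and moreover a
quasi-compact scheme-theoretically dominant `s : U → X'` with `s ≫ π = (U ↪ X)` (namely `U → X'`
onto the scheme-theoretic image of the graph; Stacks Tag 0200 and Remark Tag 0201 (2)).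
[cite: StacksProject, Tag 0200 (Lemma 30.18.1) and Tag 0201 (2)] -/
theorem exists_chow {k : Type u} [Field k] (X : Scheme.{u}) (f : X ⟶ Spec (.of k))
    [IsSeparated f] [LocallyOfFiniteType f] [QuasiCompact f] :
    ∃ (n : ℕ) (X' : Scheme.{u}) (π : X' ⟶ X) (ι : X' ⟶ (Motives.projectiveSpace n k).left) (U : X.Opens)
      (s : (U : Scheme.{u}) ⟶ X'), IsImmersion ι ∧ IsProper π ∧ Surjective π ∧
        ι ≫ (Motives.projectiveSpace n k).hom = π ≫ f ∧ Dense (U : Set X) ∧ IsIso (π ∣_ U) ∧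
        QuasiCompact s ∧ IsSchemeTheoreticallyDominant s ∧ s ≫ π = U.ι := by
  classical
  -- `X` is Noetherian
  haveI : IsLocallyNoetherian X := LocallyOfFiniteType.isLocallyNoetherian f
  haveI : CompactSpace X := QuasiCompact.compactSpace_of_compactSpace f
  haveI : IsNoetherian X := ⟨⟩
  -- Step 1: a finite affine open cover with dense intersection `U₀`
  obtain ⟨m, U, hUaff, hUcov, -, hUdense⟩ := exists_affine_cover_dense_iInf_of_isNoetherian X
  -- Step 2: immersions of the charts into projective spaces
  have hj : ∀ i, ∃ (n : ℕ) (j : (U i : Scheme.{u}) ⟶ (Motives.projectiveSpace n k).left),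
      IsImmersion j ∧ j ≫ (Motives.projectiveSpace n k).hom = (U i).ι ≫ f := fun i ↦ by
    haveI : IsAffine (U i) := hUaff i
    exact exists_immersion_projectiveSpace k ((U i).ι ≫ f)
  choose n j hj hjf using hj
  -- Step 3: the product `P` of the target projective spaces, a projective `k`-scheme
  obtain ⟨P, pr, hP, hlift⟩ := exists_weakProd m
    (fun i ↦ Motives.projectiveSpace (n i) k) fun i ↦ ⟨n i, 𝟙 _, inferInstance⟩
  haveI : IsProper P.hom := hP.isProper
  obtain ⟨N, emb, hemb⟩ := hP
  -- Step 4: the graph `e : U₀ → X ×ₖ P` of `(j₀, …, jₘ)|_{U₀}`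
  let U₀ : X.Opens := ⨅ i, U i
  have ht : ∀ i, (X.homOfLE (iInf_le U i) ≫ j i) ≫ (Motives.projectiveSpace (n i) k).hom = U₀.ι ≫ f :=
    fun i ↦ by rw [Category.assoc, hjf, Scheme.homOfLE_ι_assoc]
  let t : ∀ i, (Over.mk (U₀.ι ≫ f) : Motives.SchemeOver k) ⟶ Motives.projectiveSpace (n i) k := fun i ↦
    Over.homMk (X.homOfLE (iInf_le U i) ≫ j i) (ht i)
  obtain ⟨jt, hjt⟩ := hlift _ t
  have hw : U₀.ι ≫ f = jt.left ≫ P.hom := (Over.w jt).symm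
  let e : (U₀ : Scheme.{u}) ⟶ pullback f P.hom := pullback.lift U₀.ι jt.left hw
  haveI : NoetherianSpace (U₀ : Scheme.{u}) := NoetherianSpace.set (U₀ : Set X)
  haveI : QuasiCompact e := inferInstance
  have he₁ : e ≫ pullback.fst f P.hom = U₀.ι := pullback.lift_fst _ _ _
  have he₂ : ∀ i, e ≫ pullback.snd f P.hom ≫ (pr i).left =
      X.homOfLE (iInf_le U i) ≫ (j i).liftCoborder ≫ (j i).coborderRange.ι := fun i ↦ by
    have h : (jt.left ≫ (pr i).left : (U₀ : Scheme.{u}) ⟶ (Motives.projectiveSpace (n i) k).left) =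
        X.homOfLE (iInf_le U i) ≫ j i := congr($(hjt i).left)
    calc e ≫ pullback.snd f P.hom ≫ (pr i).left
        = (jt.left ≫ (pr i).left : (U₀ : Scheme.{u}) ⟶ (Motives.projectiveSpace (n i) k).left) := by
          rw [pullback.lift_snd_assoc]
      _ = X.homOfLE (iInf_le U i) ≫ j i := h
      _ = _ := by rw [Scheme.Hom.liftCoborder_ι]
  haveI : ∀ i, IsSeparated (Motives.projectiveSpace (n i) k).hom := fun i ↦
    (Motives.isProper_projectiveSpace (n i) k).toIsSeparated
  haveI : IsImmersion (e.imageι ≫ pullback.snd f P.hom) :=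
    isImmersion_snd f P.hom (fun i ↦ (Motives.projectiveSpace (n i) k).left)
      (fun i ↦ (Motives.projectiveSpace (n i) k).hom) (fun i ↦ (pr i).left) (fun i ↦ Over.w (pr i)) U U₀
      (fun i ↦ iInf_le U i) (fun i ↦ (j i).coborderRange) (fun i ↦ (j i).liftCoborder)
      (fun i ↦ by rw [Scheme.Hom.liftCoborder_ι_assoc, hjf]) e he₁ he₂ hUcov
  haveI := isSchemeTheoreticallyDominant_toImage e
  refine ⟨N, e.image, e.imageι ≫ pullback.fst f P.hom,
    (e.imageι ≫ pullback.snd f P.hom) ≫ emb.left, U₀, e.toImage, inferInstance, inferInstance, ?_,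
    ?_, hUdense, ?_, inferInstance, inferInstance, ?_⟩
  · exact surjective f P.hom U₀ e he₁ hUdense
  · rw [Category.assoc, Over.w emb, Category.assoc, Category.assoc, pullback.condition]
  · exact isIso_morphismRestrict f P.hom U₀ e he₁
  · rw [Scheme.Hom.toImage_imageι_assoc, he₁]


end ChowLemmaProof

open ChowLemmaProof in
/-- **Chow's lemma over a field**, discharge of the named fact `Literature.AlgebraicGeometry.Resolution.ChowLemma`: for a field
`k` and a separated `k`-scheme `X → Spec k` of finite type there are `n`, a scheme `X'`, a proper
surjective `π : X' → X`, an immersion `X' → 𝐏ⁿ_k` over `k`, and a dense open `U ⊆ X` over which `π`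
is an isomorphism (The Stacks project, Cohomology of Schemes, Lemma 30.18.1 = Tag 0200, in Section
30.18 = Tag 02O2, case `S = Spec k`; EGA II Thm. 5.6.1(a)). Proof: see the module docstring.
[cite: StacksProject, Tag 0200 (Lemma 30.18.1, Chow's lemma; Section Tag 02O2)] -/
theorem ChowLemma_holds : ChowLemma.{u} := by
  intro k _ X f hsep hlft hqc
  obtain ⟨n, X', π, ι, U, -, hι, hπ, hsurj, hcomm, hU, hiso, -⟩ := exists_chow X f
  exact ⟨n, X', π, ι, hι, hπ, hsurj, hcomm, U, hU, hiso⟩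

end Literature.AlgebraicGeometry.Resolution

end
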